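import Mathlib

/-!
# Planted symmetrisation (stub `stub_symmetrise` of line `Sketch`, crux `RazWigdersonMatching`)

Generic group-averaging lemma behind the Raz–Wigderson lower bound for monotone formulas
computing bipartite perfect matching (Rao–Yehudayoff, *Communication Complexity*, Thm. 9.5:
after a uniformly random relabelling of rows and columns the protocol's answer is "equally likely
to be one of the `k + 1` edges").

For a row/column relabelling-invariant `f` on `n × n` Boolean matrices, a labelled rectangle
partition `(A l × B l, lab l)_{l < L}` of its monotone Karchmer–Wigderson game, and planted
instance families `eA : X → f⁻¹(1)`, `eB : Y → f⁻¹(0)` with a common answer `p` such that the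
stabiliser of every instance pair in `S_n × S_n` reaches every answer from `p`, the matrix
`(x, y) ↦ 1 / #answers(eA x, eB y)` is an EXACT non-negative combination of rectangles of total
weight `≤ L`.

Proof: index the rectangles by `(τ, l) ∈ (S_n × S_n) × Fin L`, with weight
`𝟙[τ · lab l = p] / |S_n|²` and sides `{x | eA x ∘ τ ∈ A l}`, `{y | eB y ∘ τ ∈ B l}`. For fixed
`(x, y)` and `τ` exactly one `l = l(τ)` contributes (uniqueness of the part), so the combination
evaluates to `#{τ | ans τ = p} / |S_n|²` where `ans τ = τ · lab (l τ)` is an answer of `(x, y)`.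
Left multiplication by a stabiliser element `h` with `h · p = e` is a bijection from the fibre of
`ans` over `p` onto the fibre over `e`, so all fibres over the answer set have the same size and
`|S_n|² = #answers · #{τ | ans τ = p}`.
-/

set_option linter.dupNamespace false

noncomputable section

namespace Summit.ValiantsHypothesis.ValiantsHypothesis.Theorems.ShallowShadowsRazWigdersonMatching

/-- Reindexing: a non-negative rectangle combination indexed by a finite type `ι` yields one
indexed by `Fin J` with the same total weight and the same values. -/
private theorem reindex_fin {X Y ι : Type*} [Fintype ι] [DecidableEq X] [DecidableEq Y]
    (Lr : ℝ) (w : ι → ℝ) (Xs : ι → Finset X) (Ys : ι → Finset Y) (T : X → Y → ℝ)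
    (hw : ∀ i, 0 ≤ w i) (hsum : ∑ i, w i ≤ Lr)
    (hT : ∀ x y,
      ∑ i, w i * ((if x ∈ Xs i then (1 : ℝ) else 0) * (if y ∈ Ys i then (1 : ℝ) else 0)) =
        T x y) :
    ∃ (J : ℕ) (w : Fin J → ℝ) (Xs : Fin J → Finset X) (Ys : Fin J → Finset Y),
      (∀ j, 0 ≤ w j) ∧ (∑ j, w j ≤ Lr) ∧
      ∀ (x : X) (y : Y),
        ∑ j, w j * ((if x ∈ Xs j then (1 : ℝ) else 0) * (if y ∈ Ys j then (1 : ℝ) else 0)) =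
          T x y := by
  refine ⟨Fintype.card ι, w ∘ (Fintype.equivFin ι).symm, Xs ∘ (Fintype.equivFin ι).symm,
    Ys ∘ (Fintype.equivFin ι).symm, fun j => hw _, ?_, fun x y => ?_⟩
  · calc ∑ j, (w ∘ (Fintype.equivFin ι).symm) j = ∑ i, w i :=
          (Fintype.equivFin ι).symm.sum_comp w
      _ ≤ Lr := hsum
  · rw [← hT x y]
    exact (Fintype.equivFin ι).symm.sum_comp
      (fun i => w i * ((if x ∈ Xs i then (1 : ℝ) else 0) * (if y ∈ Ys i then (1 : ℝ) else 0)))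

/-- Fibre counting: if `ans : G → E` takes values in `Ans` and every `e ∈ Ans` admits a left
translation of `G` carrying the fibre over `p` onto the fibre over `e`, then
`|G| = #Ans · #(fibre over p)`. -/
private theorem card_eq_card_mul_fibre {G E : Type*} [Group G] [Fintype G] [DecidableEq E]
    (ans : G → E) (Ans : Finset E) (p : E) (hans : ∀ g, ans g ∈ Ans)
    (htrans : ∀ e ∈ Ans, ∃ h : G, ∀ g, ans (h * g) = e ↔ ans g = p) :
    Fintype.card G = Ans.card * (Finset.univ.filter fun g => ans g = p).card := by
  rw [← Finset.card_univ, Finset.card_eq_sum_card_fiberwise (f := ans) (s := Finset.univ)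
    (t := Ans) (fun g _ => hans g)]
  rw [Finset.sum_congr rfl (g := fun _ => (Finset.univ.filter fun g => ans g = p).card)]
  · rw [Finset.sum_const, smul_eq_mul]
  · intro e he
    obtain ⟨h, hh⟩ := htrans e he
    symm
    refine Finset.card_equiv (Equiv.mulLeft h) (fun g => ?_)
    simp only [Finset.mem_filter, Finset.mem_univ, true_and, Equiv.coe_mulLeft]
    exact (hh g).symm

/-- The averaged indicator of the fibre over `p` equals `1 / #Ans`. -/
private theorem sum_ite_fibre_eq {G E : Type*} [Group G] [Fintype G] [DecidableEq E]
    (ans : G → E) (Ans : Finset E) (p : E) (hans : ∀ g, ans g ∈ Ans)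
    (htrans : ∀ e ∈ Ans, ∃ h : G, ∀ g, ans (h * g) = e ↔ ans g = p) :
    (∑ g, if ans g = p then (1 : ℝ) / Fintype.card G else 0) = 1 / (Ans.card : ℝ) := by
  have hG : 0 < Fintype.card G := Fintype.card_pos
  have key := card_eq_card_mul_fibre ans Ans p hans htrans
  have hF : 0 < (Finset.univ.filter fun g => ans g = p).card := by
    rcases Nat.eq_zero_or_pos (Finset.univ.filter fun g => ans g = p).card with h0 | h0
    · rw [h0, mul_zero] at key; omega
    · exact h0
  have hA : 0 < Ans.card := Finset.card_pos.mpr ⟨_, hans 1⟩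
  rw [Finset.sum_ite, Finset.sum_const_zero, add_zero, Finset.sum_const, nsmul_eq_mul]
  have keyR : (Fintype.card G : ℝ) =
      (Ans.card : ℝ) * ((Finset.univ.filter fun g => ans g = p).card : ℝ) := by
    exact_mod_cast key
  rw [keyR]
  have hA' : (Ans.card : ℝ) ≠ 0 := by exact_mod_cast hA.ne'
  have hF' : ((Finset.univ.filter fun g => ans g = p).card : ℝ) ≠ 0 := by exact_mod_cast hF.ne'
  field_simp

/-- **Planted symmetrisation** (Rao–Yehudayoff Thm. 9.5, generic form). For a row/column
relabelling-invariant `f`, a labelled rectangle partition `(A l × B l, lab l)` of its monotone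
Karchmer–Wigderson game with `L` parts, and planted instance families `eA`, `eB` with a common
answer `p` from which the stabiliser of every instance pair reaches every answer, the matrix
`(x, y) ↦ 1 / #answers(eA x, eB y)` is an exact non-negative combination of rectangles of total
weight at most `L`. -/
theorem stub_symmetrise :
    ∀ (n L : ℕ) (X Y : Type) [Fintype X] [DecidableEq X] [Fintype Y] [DecidableEq Y]
      (f : (Fin n × Fin n → Bool) → Bool),
      (∀ (α β : Equiv.Perm (Fin n)) (z : Fin n × Fin n → Bool),
          f (fun c => z (α c.1, β c.2)) = f z) →
      ∀ (A B : Fin L → Set (Fin n × Fin n → Bool)) (lab : Fin L → Fin n × Fin n),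
      (∀ x y, f x = true → f y = false → ∃! l, x ∈ A l ∧ y ∈ B l) →
      (∀ l x y, x ∈ A l → y ∈ B l → f x = true → f y = false →
          x (lab l) = true ∧ y (lab l) = false) →
      ∀ (eA : X → (Fin n × Fin n → Bool)) (eB : Y → (Fin n × Fin n → Bool)) (p : Fin n × Fin n),
      (∀ x, f (eA x) = true) → (∀ y, f (eB y) = false) →
      (∀ x y, eA x p = true ∧ eB y p = false) →
      (∀ x y (e : Fin n × Fin n), eA x e = true → eB y e = false →
          ∃ α β : Equiv.Perm (Fin n),
            (∀ c : Fin n × Fin n, eA x (α c.1, β c.2) = eA x c) ∧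
            (∀ c : Fin n × Fin n, eB y (α c.1, β c.2) = eB y c) ∧
            (α p.1, β p.2) = e) →
      ∃ (J : ℕ) (w : Fin J → ℝ) (Xs : Fin J → Finset X) (Ys : Fin J → Finset Y),
        (∀ j, 0 ≤ w j) ∧ (∑ j, w j ≤ (L : ℝ)) ∧
        ∀ (x : X) (y : Y),
          ∑ j, w j * ((if x ∈ Xs j then (1 : ℝ) else 0) * (if y ∈ Ys j then (1 : ℝ) else 0)) =
            1 / ((Finset.univ.filter fun e : Fin n × Fin n =>
                    eA x e = true ∧ eB y e = false).card : ℝ) := by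
  intro n L X Y _ _ _ _ f hf A B lab hpart hvalid eA eB p hA hB _hp htrans
  classical
  -- the relabelling group `G = S_n × S_n`, its action on matrices and on cells
  let G := Equiv.Perm (Fin n) × Equiv.Perm (Fin n)
  let act : G → (Fin n × Fin n → Bool) → (Fin n × Fin n → Bool) :=
    fun g z c => z (g.1 c.1, g.2 c.2)
  let sm : G → Fin n × Fin n → Fin n × Fin n := fun g c => (g.1 c.1, g.2 c.2)
  -- the rectangle combination, indexed by `G × Fin L`
  let w : G × Fin L → ℝ := fun gl =>
    if sm gl.1 (lab gl.2) = p then 1 / (Fintype.card G : ℝ) else 0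
  let Xs : G × Fin L → Finset X := fun gl => Finset.univ.filter fun x => act gl.1 (eA x) ∈ A gl.2
  let Ys : G × Fin L → Finset Y := fun gl => Finset.univ.filter fun y => act gl.1 (eB y) ∈ B gl.2
  have hGpos : (0 : ℝ) < Fintype.card G := by exact_mod_cast Fintype.card_pos
  have hw0 : ∀ gl, 0 ≤ w gl := by
    intro gl
    simp only [w]
    split_ifs
    · positivity
    · exact le_rfl
  refine reindex_fin (L : ℝ) w Xs Ys
    (fun x y => 1 / ((Finset.univ.filter fun e : Fin n × Fin n =>
      eA x e = true ∧ eB y e = false).card : ℝ)) hw0 ?_ ?_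
  · -- total weight `≤ L`
    calc ∑ gl : G × Fin L, w gl ≤ ∑ _gl : G × Fin L, 1 / (Fintype.card G : ℝ) := by
          refine Finset.sum_le_sum fun gl _ => ?_
          simp only [w]
          split_ifs
          · exact le_rfl
          · positivity
      _ = (L : ℝ) := by
          rw [Finset.sum_const, Finset.card_univ, Fintype.card_prod, Fintype.card_fin,
            nsmul_eq_mul]
          push_cast
          field_simp
  · -- exact evaluation at `(x, y)`
    intro x y
    -- every relabelled instance pair is again a `(1, 0)` pair of `f`
    have hfA : ∀ g : G, f (act g (eA x)) = true := fun g => (hf g.1 g.2 (eA x)).trans (hA x)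
    have hfB : ∀ g : G, f (act g (eB y)) = false := fun g => (hf g.1 g.2 (eB y)).trans (hB y)
    -- the unique leaf of the relabelled pair and the pulled-back answer
    let l : G → Fin L := fun g => Classical.choose (hpart _ _ (hfA g) (hfB g)).exists
    have hl : ∀ g, act g (eA x) ∈ A (l g) ∧ act g (eB y) ∈ B (l g) := fun g =>
      Classical.choose_spec (hpart _ _ (hfA g) (hfB g)).exists
    have hluniq : ∀ g l', act g (eA x) ∈ A l' ∧ act g (eB y) ∈ B l' → l' = l g :=
      fun g l' h' => (hpart _ _ (hfA g) (hfB g)).unique h' (hl g)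
    let ans : G → Fin n × Fin n := fun g => sm g (lab (l g))
    -- the answer set of `(x, y)`
    set Ans : Finset (Fin n × Fin n) :=
      Finset.univ.filter fun e : Fin n × Fin n => eA x e = true ∧ eB y e = false with hAns
    have hans : ∀ g, ans g ∈ Ans := by
      intro g
      have hv := hvalid (l g) (act g (eA x)) (act g (eB y)) (hl g).1 (hl g).2 (hfA g) (hfB g)
      exact Finset.mem_filter.mpr ⟨Finset.mem_univ _, hv⟩
    -- stabiliser transitivity: left translation carries the fibre over `p` onto any fibre
    have htrans' : ∀ e ∈ Ans, ∃ h : G, ∀ g, ans (h * g) = e ↔ ans g = p := by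
      intro e he
      obtain ⟨hex, hey⟩ := (Finset.mem_filter.mp he).2
      obtain ⟨α, β, hα, hβ, hpe⟩ := htrans x y e hex hey
      refine ⟨(α, β), fun g => ?_⟩
      have hxa : act ((α, β) * g) (eA x) = act g (eA x) := by
        funext c
        exact hα (g.1 c.1, g.2 c.2)
      have hyb : act ((α, β) * g) (eB y) = act g (eB y) := by
        funext c
        exact hβ (g.1 c.1, g.2 c.2)
      have hlg : l ((α, β) * g) = l g := by
        refine (hluniq ((α, β) * g) (l g) ?_).symm
        rw [hxa, hyb]
        exact hl g
      have hans_eq : ans ((α, β) * g) = sm (α, β) (ans g) := by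
        show sm ((α, β) * g) (lab (l ((α, β) * g))) = sm (α, β) (sm g (lab (l g)))
        rw [hlg]
        rfl
      rw [hans_eq, ← hpe]
      constructor
      · intro h'
        have h1 := congrArg Prod.fst h'
        have h2 := congrArg Prod.snd h'
        exact Prod.ext (α.injective h1) (β.injective h2)
      · intro h'
        rw [h']
    -- the fibre identity
    have hfib := sum_ite_fibre_eq ans Ans p hans htrans'
    -- unfold the rectangle combination: for fixed `g` only the leaf `l g` contributes
    have hinner : ∀ g : G,
        ∑ l' : Fin L, w (g, l') * ((if x ∈ Xs (g, l') then (1 : ℝ) else 0) *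
          (if y ∈ Ys (g, l') then (1 : ℝ) else 0)) =
          if ans g = p then (1 : ℝ) / Fintype.card G else 0 := by
      intro g
      rw [Fintype.sum_eq_single (l g)]
      · have h1 : x ∈ Xs (g, l g) := Finset.mem_filter.mpr ⟨Finset.mem_univ _, (hl g).1⟩
        have h2 : y ∈ Ys (g, l g) := Finset.mem_filter.mpr ⟨Finset.mem_univ _, (hl g).2⟩
        rw [if_pos h1, if_pos h2, mul_one, mul_one]
      · intro l' hl'
        have hnot : ¬ (x ∈ Xs (g, l') ∧ y ∈ Ys (g, l')) := by
          rintro ⟨h1, h2⟩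
          exact hl' (hluniq g l' ⟨(Finset.mem_filter.mp h1).2, (Finset.mem_filter.mp h2).2⟩)
        by_cases h1 : x ∈ Xs (g, l')
        · have h2 : y ∉ Ys (g, l') := fun h2 => hnot ⟨h1, h2⟩
          rw [if_neg h2, mul_zero, mul_zero]
        · rw [if_neg h1, zero_mul, mul_zero]
    rw [Fintype.sum_prod_type, Finset.sum_congr rfl fun g _ => hinner g]
    exact hfib

end Summit.ValiantsHypothesis.ValiantsHypothesis.Theorems.ShallowShadowsRazWigdersonMatching

end
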